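import Mathlib.Combinatorics.SimpleGraph.Coloring.Vertex
import Mathlib.Combinatorics.SimpleGraph.Hamiltonian
import Mathlib.Data.Fintype.Card
import Mathlib.Order.Filter.AtTopBot.Basic
import Literature.ModelTheory.FiniteModelTheory.CkEquiv
import Literature.ModelTheory.FiniteModelTheory.CapturingPTIME
import Literature.Combinatorics.SimpleGraph.HamiltonianCycleListings
import HarnessLib

/-!
# Counting width of a class of finite graphs; linear counting width of Hamiltonicity and
3-colourability (Atserias–Dawar–Ochremiak)

Topic `Literature/ModelTheory/FiniteModelTheory`. Definition request `defn-CountingWidth`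
(routes PneNP/SymmetryBudget — proofs of `PolylogBarrier`, `PolylogHam` — and PneNP/Descriptive)
and fact request `wi-09671`. Builds on `CkEquiv k G H` (`G ≡^{C^k} H`, Duplicator wins Hella's
bijective `k`-pebble game; `Literature.ModelTheory.FiniteModelTheory.CkEquiv`) and on the tree's
`FinGraph = Σ n, SimpleGraph (Fin n)` / `IsIsoClosed` (`…CapturingPTIME`).

## Content

* `CkEquiv.nonempty_iso` (proved): with `k ≥ |V(G)|` pebble pairs, `k ≥ 1`, `G ≡^{C^k} H` forces
  `G ≃g H` (Spoiler pebbles every vertex; Dawar–Wilsenach 2025, §2.4: "If `k ≥ n`, then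
  `Γ ≡_k Δ` implies that `Γ` and `Δ` are isomorphic").
* `countingWidth 𝒞 : ℕ → ℕ` — the COUNTING WIDTH of a class `𝒞` of finite graphs (Dawar–Wang
  2017; Atserias–Dawar 2019, §2.1: "`k(n)` is the smallest value such that for any `𝔸 ∈ 𝒞_n` and
  any `𝔹 ∉ 𝒞`, we have `𝔸 ≢^{C^{k(n)}} 𝔹`", `𝒞_n` = members with at most `n` elements;
  Dawar–Wilsenach 2025, Def. 2.1 is the same notion for graph parameters, indexed by
  Weisfeiler–Leman dimension `= k - 1`), with the proved API `countingWidth_le` (`≤ n` for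
  isomorphism-closed `𝒞`, `n ≥ 1`; loc. cit. "Note that `k(n) ≤ n`"), `countingWidth_separates`
  (the infimum is attained) and `countingWidth_induction` (lower-bound principle: whatever holds
  of every `k` at which `𝒞` is `≡^{C^k}`-invariant on `n`-vertex graphs holds of
  `countingWidth 𝒞 n`).
* NAMED FACTS (cited, not proved): `AtseriasDawarOchremiak2021_hamiltonicity_countingWidth`
  (arXiv:1901.07825 Lemma 14) and `AtseriasDawarOchremiak2021_threeColourability_countingWidth`
  (the unrestricted-classes consequence of Lemma 13), in the invariance form explained below;
  proved corollaries `….le_countingWidth` ("Hamiltonicity and 3-colourability have linear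
  counting width", Dawar–Wilsenach 2025, §2.4) and the isomorphism-closure of both classes.

## Sources

* A. Atserias, A. Dawar, *Definable inapproximability: new challenges for duplicator*, J. Logic
  Comput. 29 (2019), arXiv:1806.11307, §2.1 (`C^k`, the bijective game, counting width of a
  class, "`k(n) ≤ n`", "`k(n)` is also the smallest value such that `𝒞_n` is a union of
  `≡^{C^{k(n)}}`-classes"). Read: arXiv text, §2.1.
* A. Atserias, A. Dawar, J. Ochremiak, *On the power of symmetric linear programs*, LICS 2019 /
  J. ACM 68(4) (2021) Art. 26; arXiv:1901.07825, §5.2: Lemma 13 ("There exist `c, d > 0` such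
  that, for every `k` and every sufficiently large `n`, every `C^k`-sentence that separates the
  class of 3-colourable graphs with `n` vertices and `cn` edges from the class of
  non-3-colourable ones has `k ≥ dn`") and Lemma 14 ("There exists `d > 0` such that, for every
  `k` and every sufficiently large `n`, every `C^k`-formula that defines the class of Hamiltonian
  graphs with `n` vertices has `k ≥ dn`"); lemma numbers of the arXiv version. Read: §5.2.
* A. Dawar, G. Wilsenach, *Symmetric arithmetic circuits*, Theory Comput. 21 (2025), §2.4 and
  Def. 2.1 ("many graph properties have been shown to have linear counting width, including
  Hamiltonicity and 3-colourability (see [5])"; "`ν(n) ≤ n`"). Read: pp. 5–6.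

## Design choices and wording risks

* `countingWidth` is an `sInf` over `ℕ` of `{k | ∀ A ∈ 𝒞, |A| ≤ n → ∀ B ∉ 𝒞, A ≢^{C^k} B}`
  (Atserias–Dawar's wording, `B` of any order); non-empty — so the infimum is attained — for
  isomorphism-closed `𝒞` and `n ≥ 1` (`k = n` works: different orders are told apart by
  Duplicator's first bijection, equal orders by `CkEquiv.nonempty_iso`); at `n = 0` the value
  may be a junk `0` or `1`. For `𝒞 = ∅` or `𝒞 = univ` it is `0`.
* The Atserias–Dawar–Ochremiak lemmas speak of `C^k`-sentences DEFINING (SEPARATING) classes of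
  `n`-vertex graphs. On `n`-vertex graphs a class is definable by a `C^k`-sentence iff it is a
  union of `≡^{C^k}`-classes, and two classes are separable iff no member of one is `≡^{C^k}` to a
  member of the other (Hella's theorem — the tree's definition of `CkEquiv` — and finitely many
  isomorphism types; Atserias–Dawar 2019 §2.1 makes the same remark for counting width), so
  both lemmas are stated as INVARIANCE of the property under `CkEquiv k` over
  `SimpleGraph (Fin n)`. "For every `k` and every sufficiently large `n`" is read with the
  threshold independent of `k` — the reading under which the paper derives the `2^{Ω(n)}` size
  bounds of its Theorem 2 from the lemmas and under which Dawar–Wilsenach call the result linear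
  counting width; with a `k`-dependent threshold the statements would carry no asymptotic
  content.
* Lemma 13 is vendored for the UNRESTRICTED classes only (a sentence separating all 3-colourable
  `n`-vertex graphs from all non-3-colourable ones in particular separates the sparse ones, so
  this is implied by the printed lemma under either reading — exactly / at most — of "`cn`
  edges"); the sparsity refinement is not vendored.
* Hamiltonicity is Mathlib's `SimpleGraph.IsHamiltonian` (its conventions on `≤ 2` vertices are
  irrelevant under `∀ᶠ n`); 3-colourability is `SimpleGraph.Colorable 3`.
* NOT here: the Hamiltonian-PATH variant of Lemma 14 wanted by `PolylogHam` — not in print (the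
  paper treats cycles; the item calls the path version "a routine but unwritten modification"),
  so not vendored as a cited fact; it follows from Lemma 14 by the usual cycle-to-path gadget and
  the closure of `≡^{C^k}` under first-order interpretations (Atserias–Dawar 2019, Lemma 2.1),
  itself not yet in the tree (see the docstring of `…CkEquiv`). Also not here: the
  Cai–Fürer–Immerman lower bound and the supports-to-counting-width transfer for symmetric
  circuits (Anderson–Dawar 2017, Thm 6; Dawar–Wilsenach 2025, Thm 6.4) — separate fact requests.
-/

namespace Literature.ModelTheory.FiniteModelTheory

open Finset Filter

/-! ## Enough pebbles decide isomorphism -/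

/-- With at least as many pebble pairs as vertices (and at least one), `≡^{C^k}` is isomorphism:
Spoiler pebbles every vertex one at a time (fewer than `k` pairs are on the board before each
move), and Duplicator's forced answers assemble into a total partial isomorphism, i.e. an
isomorphism (Dawar–Wilsenach 2025, §2.4: "If `k ≥ n`, then `Γ ≡_k Δ` implies that `Γ` and `Δ` are
isomorphic"; there `≡_k` is `k`-WL, i.e. `C^{k+1}`, and already `k` pebble PAIRS suffice).
[cite: DawarWilsenach2025, §2.4] -/
theorem CkEquiv.nonempty_iso {α β : Type*} [Fintype α] [Fintype β] {G : SimpleGraph α}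
    {H : SimpleGraph β} {k : ℕ} (h : CkEquiv k G H) (hk : 0 < k) (hV : Fintype.card α ≤ k) :
    Nonempty (G ≃g H) := by
  classical
  have hcard : Fintype.card α = Fintype.card β := h.card_eq hk
  obtain ⟨S⟩ := h
  -- pebble the vertices of `t` one by one
  have key : ∀ t : Finset α, ∃ p ∈ S.carrier, (∀ a ∈ t, ∃ b, (a, b) ∈ p) ∧ p.ncard ≤ t.card := by
    intro t
    induction t using Finset.induction_on with
    | empty => exact ⟨∅, S.empty_mem, by simp, by simp⟩
    | @insert a t hat ih =>
      obtain ⟨p, hp, hdom, hpt⟩ := ih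
      have hlt : p.ncard < k := by
        have h1 : (insert a t).card ≤ Fintype.card α := card_le_univ _
        rw [card_insert_of_notMem hat] at h1
        omega
      obtain ⟨f, hins⟩ := S.forth hp hlt
      refine ⟨insert (a, f a) p, hins a, fun a' ha' => ?_, ?_⟩
      · rcases mem_insert.1 ha' with rfl | ha'
        · exact ⟨f a', Set.mem_insert _ _⟩
        · obtain ⟨b, hb⟩ := hdom a' ha'
          exact ⟨b, Set.mem_insert_of_mem _ hb⟩
      · rw [card_insert_of_notMem hat]
        exact (Set.ncard_insert_le _ _).trans (Nat.succ_le_succ hpt)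
  obtain ⟨p, hp, hdom, -⟩ := key univ
  have hiso := S.isPartialIso_of_mem hp
  choose g hg using fun a => hdom a (mem_univ a)
  have hinj : Function.Injective g := fun a a' h => (hiso.eq_iff (hg a) (hg a')).2 h
  have hbij : Function.Bijective g :=
    (Fintype.bijective_iff_injective_and_card g).2 ⟨hinj, hcard⟩
  exact ⟨⟨Equiv.ofBijective g hbij, fun {a b} => (hiso.adj_iff (hg a) (hg b)).symm⟩⟩

/-! ## Counting width -/

/-- **The counting width** of a class `𝒞` of finite graphs (Dawar–Wang 2017; Atserias–Dawar
2019, §2.1: "the function `k : ℕ → ℕ` where `k(n)` is the smallest value such that for any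
`𝔸 ∈ 𝒞_n` and any `𝔹 ∉ 𝒞`, we have `𝔸 ≢^{C^{k(n)}} 𝔹`", `𝒞_n` = members with at most `n`
elements; equivalently the least `k` such that `𝒞_n` is a union of `≡^{C^k}`-classes;
Dawar–Wilsenach 2025, Def. 2.1 is the same notion for graph parameters, indexed by
Weisfeiler–Leman dimension `= k - 1`). An `sInf` over `ℕ`: for isomorphism-closed `𝒞` and
`n ≥ 1` the set is non-empty and `countingWidth 𝒞 n ≤ n` (`countingWidth_le`).
[cite: AtseriasDawar2019, §2.1 (counting width)] -/
noncomputable def countingWidth (𝒞 : Set FinGraph) (n : ℕ) : ℕ :=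
  sInf {k : ℕ | ∀ A ∈ 𝒞, A.1 ≤ n → ∀ B ∉ 𝒞, ¬ CkEquiv k A.2 B.2}

/-- For an isomorphism-closed class, `k` pebble pairs with `k ≥ n`, `k ≥ 1` separate every member
with at most `n` vertices from every non-member (different orders are told apart by one
bijection move, equal orders by `CkEquiv.nonempty_iso`).
[cite: AtseriasDawar2019, §2.1 ("Note that k(n) ≤ n")] -/
theorem separates_of_le {𝒞 : Set FinGraph} (h𝒞 : IsIsoClosed 𝒞) {n k : ℕ} (hk : 1 ≤ k)
    (hnk : n ≤ k) : ∀ A ∈ 𝒞, A.1 ≤ n → ∀ B ∉ 𝒞, ¬ CkEquiv k A.2 B.2 := by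
  rintro ⟨m, G⟩ hA hm ⟨m', H⟩ hB heq
  have hmk : Fintype.card (Fin m) ≤ k := by simpa using hm.trans hnk
  obtain ⟨e⟩ := heq.nonempty_iso hk hmk
  exact hB ((h𝒞 G H ⟨e⟩).1 hA)

/-- **`countingWidth 𝒞 n ≤ n`** for isomorphism-closed `𝒞` and `n ≥ 1` (Atserias–Dawar 2019,
§2.1: "Note that `k(n) ≤ n`"; Dawar–Wilsenach 2025, after Def. 2.1).
[cite: AtseriasDawar2019, §2.1] -/
theorem countingWidth_le {𝒞 : Set FinGraph} (h𝒞 : IsIsoClosed 𝒞) {n : ℕ} (hn : 1 ≤ n) :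
    countingWidth 𝒞 n ≤ n :=
  Nat.sInf_le (separates_of_le h𝒞 hn le_rfl)

/-- The defining property holds at the counting width itself (isomorphism-closed `𝒞`, `n ≥ 1`):
members with at most `n` vertices are `C^{countingWidth 𝒞 n}`-inequivalent to non-members.
[cite: AtseriasDawar2019, §2.1] -/
theorem countingWidth_separates {𝒞 : Set FinGraph} (h𝒞 : IsIsoClosed 𝒞) {n : ℕ} (hn : 1 ≤ n) :
    ∀ A ∈ 𝒞, A.1 ≤ n → ∀ B ∉ 𝒞, ¬ CkEquiv (countingWidth 𝒞 n) A.2 B.2 :=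
  Nat.sInf_mem (s := {k : ℕ | ∀ A ∈ 𝒞, A.1 ≤ n → ∀ B ∉ 𝒞, ¬ CkEquiv k A.2 B.2})
    ⟨n, separates_of_le h𝒞 hn le_rfl⟩

/-- Any `k` at which members of `𝒞` with at most `n` vertices are separated from non-members
bounds the counting width from above. [cite: AtseriasDawar2019, §2.1] -/
theorem countingWidth_le_of_separates {𝒞 : Set FinGraph} {n k : ℕ}
    (h : ∀ A ∈ 𝒞, A.1 ≤ n → ∀ B ∉ 𝒞, ¬ CkEquiv k A.2 B.2) : countingWidth 𝒞 n ≤ k :=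
  Nat.sInf_le h

/-- Lower-bound principle: whatever holds of every `k` at which `𝒞` is `≡^{C^k}`-invariant on
`n`-vertex graphs holds of `countingWidth 𝒞 n` (isomorphism-closed `𝒞`, `n ≥ 1`); e.g. with
`P k := d·n ≤ k`. [folklore] -/
theorem countingWidth_induction {𝒞 : Set FinGraph} (h𝒞 : IsIsoClosed 𝒞) {n : ℕ} (hn : 1 ≤ n)
    {P : ℕ → Prop}
    (hP : ∀ k, (∀ G H : SimpleGraph (Fin n), CkEquiv k G H → (⟨n, G⟩ ∈ 𝒞 ↔ ⟨n, H⟩ ∈ 𝒞)) → P k) :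
    P (countingWidth 𝒞 n) := by
  refine hP _ fun G H heq => ?_
  have hsep := countingWidth_separates h𝒞 hn
  constructor
  · intro hG
    by_contra hH
    exact hsep ⟨n, G⟩ hG le_rfl ⟨n, H⟩ hH heq
  · intro hH
    by_contra hG
    exact hsep ⟨n, H⟩ hH le_rfl ⟨n, G⟩ hG heq.symm

/-! ## Linear counting width of Hamiltonicity and 3-colourability (Atserias–Dawar–Ochremiak) -/

/-- **Linear counting width of Hamiltonicity** (Atserias–Dawar–Ochremiak, arXiv:1901.07825
Lemma 14 = LICS 2019 / J. ACM 68(4) Art. 26, §5.2): "There exists `d > 0` such that, for every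
`k` and every sufficiently large `n`, every `C^k`-formula that defines the class of Hamiltonian
graphs with `n` vertices has `k ≥ dn`." Rendered on `SimpleGraph (Fin n)` with Mathlib's
`IsHamiltonian`: a `C^k`-sentence defines Hamiltonicity on `n`-vertex graphs iff Hamiltonicity is
`≡^{C^k}`-invariant there (Hella's theorem and finitely many isomorphism types; module
docstring), so: there is `d > 0` such that for all sufficiently large `n` and every `k`, if
`≡^{C^k}` graphs on `Fin n` are simultaneously Hamiltonian or not, then `d·n ≤ k`. "Sufficiently
large `n`" is uniform in `k` — the reading under which the paper derives the `2^{Ω(n)}` bounds of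
its Theorem 2 from the lemma and under which Dawar–Wilsenach 2025, §2.4 quote it ("many graph
properties have been shown to have linear counting width, including Hamiltonicity and
3-colourability (see [5])"). Proof in the source: a linear-size quantifier-free interpretation
of the textbook 3-SAT-to-Hamiltonicity reduction with the variable gadgets arranged in a clique
instead of a path, on top of the linear bound for 3-SAT (Atserias–Dawar 2019, Thms 3.7–3.8).
[cite: AtseriasDawarOchremiak2021, §5.2, Lemma 14 of arXiv:1901.07825] -/
def AtseriasDawarOchremiak2021_hamiltonicity_countingWidth : Prop :=
  ∃ d : ℝ, 0 < d ∧ ∀ᶠ n : ℕ in atTop, ∀ k : ℕ,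
    (∀ G H : SimpleGraph (Fin n), CkEquiv k G H → (G.IsHamiltonian ↔ H.IsHamiltonian)) →
      d * n ≤ k

/-- **Linear counting width of 3-colourability** (Atserias–Dawar–Ochremiak, arXiv:1901.07825
Lemma 13 = J. ACM 68(4) Art. 26, §5.2): "There exist `c, d > 0` such that, for every `k` and
every sufficiently large `n`, every `C^k`-sentence that separates the class of 3-colourable
graphs with `n` vertices and `cn` edges from the class of non-3-colourable ones has `k ≥ dn`."
Vendored is its consequence for the UNRESTRICTED classes (a sentence separating all
3-colourable `n`-vertex graphs from all non-3-colourable ones in particular separates the sparse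
ones; the sparsity refinement "`cn` edges", ambiguous between exactly and at most, is not
vendored): there is `d > 0` such that for all sufficiently large `n` (uniformly in `k`, as for
Lemma 14) and every `k`, if 3-colourability is `≡^{C^k}`-invariant on graphs on `Fin n` — i.e. no
3-colourable one is `≡^{C^k}` to a non-3-colourable one, which by Hella's theorem is separability
by a `C^k`-sentence — then `d·n ≤ k`. Quoted as linear counting width of 3-colourability in
Dawar–Wilsenach 2025, §2.4. Proof in the source: the textbook 3-SAT-to-3-colouring reduction as
a linear-size quantifier-free interpretation, on top of Atserias–Dawar 2019, Thms 3.7–3.8.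
[cite: AtseriasDawarOchremiak2021, §5.2, Lemma 13 of arXiv:1901.07825 (unrestricted classes)] -/
def AtseriasDawarOchremiak2021_threeColourability_countingWidth : Prop :=
  ∃ d : ℝ, 0 < d ∧ ∀ᶠ n : ℕ in atTop, ∀ k : ℕ,
    (∀ G H : SimpleGraph (Fin n), CkEquiv k G H → (G.Colorable 3 ↔ H.Colorable 3)) →
      d * n ≤ k

/-- The class of Hamiltonian finite graphs is isomorphism-closed. [folklore] -/
theorem isIsoClosed_isHamiltonian : IsIsoClosed {A : FinGraph | A.2.IsHamiltonian} :=
  fun _ _ _ _ ⟨e⟩ => Literature.Combinatorics.SimpleGraph.isHamiltonian_iff_of_iso e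

/-- The class of 3-colourable finite graphs is isomorphism-closed. [folklore] -/
theorem isIsoClosed_colorable_three : IsIsoClosed {A : FinGraph | A.2.Colorable 3} :=
  fun _ _ _ _ ⟨e⟩ =>
    ⟨fun h => h.of_hom e.symm.toHom, fun h => h.of_hom e.toHom⟩

/-- Corollary in terms of `countingWidth`: the counting width of Hamiltonicity is at least `d·n`
for all large `n` (Lemma 14 in the language of Dawar–Wilsenach 2025, §2.4).
[cite: AtseriasDawarOchremiak2021, §5.2, Lemma 14 of arXiv:1901.07825] -/
theorem AtseriasDawarOchremiak2021_hamiltonicity_countingWidth.le_countingWidth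
    (h : AtseriasDawarOchremiak2021_hamiltonicity_countingWidth) :
    ∃ d : ℝ, 0 < d ∧ ∀ᶠ n : ℕ in atTop,
      d * n ≤ countingWidth {A : FinGraph | A.2.IsHamiltonian} n := by
  obtain ⟨d, hd, hev⟩ := h
  refine ⟨d, hd, ?_⟩
  filter_upwards [hev, eventually_ge_atTop 1] with n hn hn1
  exact countingWidth_induction (P := fun k => d * n ≤ (k : ℝ)) isIsoClosed_isHamiltonian hn1
    fun k hk => hn k fun G H heq => hk G H heq

/-- Corollary in terms of `countingWidth`: the counting width of 3-colourability is at least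
`d·n` for all large `n` (Lemma 13 in the language of Dawar–Wilsenach 2025, §2.4).
[cite: AtseriasDawarOchremiak2021, §5.2, Lemma 13 of arXiv:1901.07825] -/
theorem AtseriasDawarOchremiak2021_threeColourability_countingWidth.le_countingWidth
    (h : AtseriasDawarOchremiak2021_threeColourability_countingWidth) :
    ∃ d : ℝ, 0 < d ∧ ∀ᶠ n : ℕ in atTop,
      d * n ≤ countingWidth {A : FinGraph | A.2.Colorable 3} n := by
  obtain ⟨d, hd, hev⟩ := h
  refine ⟨d, hd, ?_⟩
  filter_upwards [hev, eventually_ge_atTop 1] with n hn hn1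
  exact countingWidth_induction (P := fun k => d * n ≤ (k : ℝ)) isIsoClosed_colorable_three hn1
    fun k hk => hn k fun G H heq => hk G H heq

end Literature.ModelTheory.FiniteModelTheory
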